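import Summits.QuantumFields.GaugeBoot.TiltedBoxLimitStrongCoupling
import Summits.Ventures.YMGap.Thresholds.StrongCouplingAllGroupsSharp
import HarnessLib

/-!
# Class B at strong coupling for EVERY compact gauge group; the in-plane contrast beyond `SU(N)` (gauge-boot, L3 supplement)

HONEST FRAMING (cell `pub-gaugeboot`, page 1 of every file): the venture produces certified bounds
on lattice expectations at stated coupling, gauge group, dimension and torus size; NOT a mass gap,
NOT a continuum limit, NOT a string tension; NOT Yang–Mills-summit-bearing (barriers
`FixedCouplingUltralocality`, `PerturbativeInvisibility`). This module is a STRONG-COUPLING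
statement about lattice states; nothing is claimed at the couplings of the cell's certificates.

## Content

`ClassBStrongCoupling.lean` (gen 2) identified the Class-B states with the torus limit points
wherever the DLR state is unique and discharged uniqueness for `SU(N)` only (Shen–Zhu–Zhu). The
cell `pub-ymgap` has since landed Dobrushin uniqueness for EVERY compact metrisable gauge group
(`Summit.Ventures.YMGap.StrongCouplingAllGroupsSharp.subsingleton_ymGibbsMeasures_sharp`:
`|𝒢(β)| ≤ 1` at `6(d-1) C_ρ |β| < 1`, `|Re tr ρ(U_p)| ≤ C_ρ`). With `C_ρ = N` for a continuous
`N`-dimensional `ρ` (unitary trick) this gives, for every compact metrisable `G` (in `Type`) and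
every continuous `ρ`:

* **`subsingleton_ymGibbsMeasures_allGroups`** — `|𝒢(β)| ≤ 1` for `6(d-1) N |β| < 1`;
* ★ **`thermodynamicLimitIsClassB_allGroups`** — `ThermodynamicLimitIsClassB d ρ β` for
  `0 ≤ β`, `6(d-1) N β < 1`: every torus limit point is a Class-B state — the R8 inhabitation line
  now for `U(N)`, `SO(N)`, finite groups, … (**`nonempty_classBState_allGroups`**), and every
  TILTED limit point too (**`exists_classBState_eq_of_mem_tiltedBoxLimitPoints_allGroups`**,
  **`axisRP_of_mem_tiltedBoxLimitPoints_allGroups`**: site- and link-RP along EVERY axis);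
* ★ **`boxes_fail_limit_holds_inPlaneRP_of_moments`** — THE CONTRAST of
  `TiltedBoxLimitStrongCoupling` for a general compact `G` with a centre element `ρ z₀ = ω • 1`
  (`ω ≠ 1`) and the character identity (R1) with `c₁ > 0`, and a transverse direction pair
  (`d ≥ 3`): one `β₁ > 0` such that for `0 < β ≤ β₁` every square tilted box `P, L ≥ 2` FAILS the
  reduced-half in-plane site and link RP along `i`, YET every tilted limit point IS site- and
  link-RP along `i`; **`boxes_fail_limit_holds_inPlaneRP_unitary`** — `G ≅ U(N)`, `N ≥ 1`.

Windows: uniqueness `β < 1/(6(d-1)N)`; the box window is the (far smaller) `β₀` of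
`TiltedBoxRedSiteRPNegativeUniform`. Nothing at moderate `β`.
-/

noncomputable section

open MeasureTheory Filter Topology
open scoped ComplexConjugate ComplexOrder
open Literature.MathematicalPhysics.QuantumLattice
open Literature.MathematicalPhysics.QuantumFieldTheory (haarProbability IsUnitaryModel)
open Literature.MathematicalPhysics.QuantumFieldTheory.PlaquetteLowerBound (reTr)
open Literature.RepresentationTheory.CompactGroups

namespace Summit.QuantumFields.GaugeBoot

variable {d N : ℕ} {G : Type} [Group G] [TopologicalSpace G] [IsTopologicalGroup G] [CompactSpace G]
  [MeasurableSpace G] [BorelSpace G] [T2Space G] [SecondCountableTopology G]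
variable (ρ : G →* Matrix (Fin N) (Fin N) ℂ)

/-! ## Uniqueness and Class B for every compact group -/

omit [MeasurableSpace G] [BorelSpace G] [T2Space G] [SecondCountableTopology G] in
/-- `|Re tr ρ(U_p)| ≤ N` for the `ℤ^d` plaquette observable of a continuous `N`-dimensional
representation of a compact group (unitary trick). [folklore] -/
theorem abs_plaquetteObs_le_card (hρ : Continuous ρ) (z : Literature.Probability.LatticeModels.Site d)
    (i j : Fin d) (U : LGConfig d G) : |plaquetteObs ρ z i j U| ≤ N := by
  simpa [plaquetteObs] using CompactGroup.abs_re_trace_le_card ρ hρ (plaquetteHolonomyZd U z i j)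

/-- **DLR uniqueness for EVERY compact metrisable gauge group at `6(d-1) N |β| < 1`** (the cell
`pub-ymgap`'s Dobrushin corner `subsingleton_ymGibbsMeasures_sharp` with `C_ρ = N`). [folklore] -/
theorem subsingleton_ymGibbsMeasures_allGroups (hρ : Continuous ρ) {β : ℝ}
    (hβ : 6 * ((d - 1 : ℕ) : ℝ) * N * |β| < 1) : (ymGibbsMeasures (d := d) ρ β).Subsingleton :=
  Summit.Ventures.YMGap.StrongCouplingAllGroupsSharp.subsingleton_ymGibbsMeasures_sharp ρ hρ
    (Nat.cast_nonneg N) (abs_plaquetteObs_le_card ρ hρ) hβ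

/-- ★ **CLASS B AT STRONG COUPLING FOR EVERY COMPACT GAUGE GROUP**: for compact metrisable `G`,
continuous `ρ`, `0 ≤ β` with `6(d-1) N β < 1`, every infinite-volume limit point of the torus Wilson
states is a Class-B state (`thermodynamicLimitIsClassB_of_subsingleton` + Dobrushin uniqueness).
`ClassBStrongCoupling.thermodynamicLimitIsClassB_SU_strongCoupling` had this for `SU(N)` only.
[folklore] -/
theorem thermodynamicLimitIsClassB_allGroups [NeZero d] (hρ : Continuous ρ) {β : ℝ} (hβ0 : 0 ≤ β)
    (hβ : 6 * ((d - 1 : ℕ) : ℝ) * N * β < 1) : ThermodynamicLimitIsClassB d ρ β :=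
  thermodynamicLimitIsClassB_of_subsingleton ρ hρ hβ0
    (subsingleton_ymGibbsMeasures_allGroups ρ hρ (by rwa [abs_of_nonneg hβ0]))

/-- **The R8 inhabitation line for every compact group**: Class-B states EXIST at `0 ≤ β`,
`6(d-1) N β < 1`. [folklore] -/
theorem nonempty_classBState_allGroups [NeZero d] (hρ : Continuous ρ) {β : ℝ} (hβ0 : 0 ≤ β)
    (hβ : 6 * ((d - 1 : ℕ) : ℝ) * N * β < 1) : Nonempty (ClassBState d ρ β) :=
  nonempty_classBState_of_subsingleton ρ hρ hβ0
    (subsingleton_ymGibbsMeasures_allGroups ρ hρ (by rwa [abs_of_nonneg hβ0]))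

namespace TiltedRP

variable {i j : Fin d}

/-- **Every TILTED limit point is a Class-B state at strong coupling, every compact group**
(`0 ≤ β`, `6(d-1) N β < 1`). [folklore] -/
theorem exists_classBState_eq_of_mem_tiltedBoxLimitPoints_allGroups [NeZero d] (hρ : Continuous ρ)
    {β : ℝ} (hβ0 : 0 ≤ β) (hβ : 6 * ((d - 1 : ℕ) : ℝ) * N * β < 1) {μ : Measure (LGConfig d G)}
    (hμ : μ ∈ tiltedBoxLimitPoints d i j ρ β) : ∃ ω : ClassBState d ρ β, ω.μ = μ :=
  exists_classBState_eq_of_mem_tiltedBoxLimitPoints_of_subsingleton_TI ρ hρ hβ0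
    (subsingleton_ymGibbsMeasuresTI_of_subsingleton ρ
      (subsingleton_ymGibbsMeasures_allGroups ρ hρ (by rwa [abs_of_nonneg hβ0]))) hμ

/-- **Every tilted limit point is site-RP and link-RP along EVERY axis at strong coupling, every
compact group** — in-plane axes included (`0 ≤ β`, `6(d-1) N β < 1`). [folklore] -/
theorem axisRP_of_mem_tiltedBoxLimitPoints_allGroups [NeZero d] (hρ : Continuous ρ) {β : ℝ}
    (hβ0 : 0 ≤ β) (hβ : 6 * ((d - 1 : ℕ) : ℝ) * N * β < 1) {μ : Measure (LGConfig d G)}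
    (hμ : μ ∈ tiltedBoxLimitPoints d i j ρ β) (k : Fin d) :
    IsReflectionPositiveFor (configSiteReflect (G := G) k) (siteHalfEdges k) μ ∧
      IsReflectionPositiveFor (configLinkReflect (G := G) k) (linkHalfEdges k) μ := by
  obtain ⟨ω, hω⟩ := exists_classBState_eq_of_mem_tiltedBoxLimitPoints_allGroups ρ hρ hβ0 hβ hμ
  exact ⟨hω ▸ ω.siteRP k, hω ▸ ω.linkRP k⟩

/-! ## The in-plane contrast for a general compact group -/

/-- ★ **THE CONTRAST, general compact group.** `G` compact metrisable (in `Type`), `ρ` continuous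
(`N ≥ 1`) with a centre element `ρ z₀ = ω • 1`, `ω ≠ 1`, and (R1) with `c₁ > 0`; a direction pair
`q = (q₁, q₂)` with `q₁, q₂ ≠ i` (`d ≥ 3`). Then there is `β₁ > 0` such that for every `0 < β ≤ β₁`:
(a) on EVERY square tilted box of the plane `(i, j)` (`P, L ≥ 2`) reduced-half site RP (even box)
and reduced-half link RP (odd box) along `i` FAIL; (b) every tilted LIMIT point at coupling `β` is
site-RP and link-RP along `i` (Dobrushin uniqueness ⇒ Class B). [folklore] -/
theorem boxes_fail_limit_holds_inPlaneRP_of_moments (q : DirPair d) (hij : i ≠ j) (hq1 : q.1.1 ≠ i)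
    (hq2 : q.1.2 ≠ i) (hρ : Continuous ρ) (hN : 1 ≤ N) {z₀ : G} {ω : ℂ}
    (hz₀ : ρ z₀ = ω • (1 : Matrix (Fin N) (Fin N) ℂ)) (hω : ω ≠ 1) {c₁ : ℝ} (hc₁ : 0 < c₁)
    (hR1 : ∀ x y : G, ∫ g, reTr ρ (x * g⁻¹) * reTr ρ (g * y) ∂haarProbability G = c₁ * reTr ρ (x * y)) :
    ∃ β₁ : ℝ, 0 < β₁ ∧ ∀ β : ℝ, 0 < β → β ≤ β₁ →
      (∀ (P L : ℕ) [NeZero P] [NeZero L], 2 ≤ P → 2 ≤ L →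
        ¬ RedSite.RedSiteRP d i j L P ρ hij β ∧ ¬ RedLink.RedLinkRP d i j L P ρ hij β) ∧
      (∀ μ ∈ tiltedBoxLimitPoints d i j ρ β,
        IsReflectionPositiveFor (configSiteReflect (G := G) i) (siteHalfEdges i) μ ∧
          IsReflectionPositiveFor (configLinkReflect (G := G) i) (linkHalfEdges i) μ) := by
  haveI : NeZero d := ⟨by have := i.isLt; omega⟩
  have hNr : (1 : ℝ) ≤ N := by exact_mod_cast hN
  have hD0 : (0 : ℝ) ≤ 6 * ((d - 1 : ℕ) : ℝ) * N := by positivity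
  have hW : (0 : ℝ) < 12 * ((d - 1 : ℕ) : ℝ) * N + 1 := by positivity
  obtain ⟨βs, hβs, hs⟩ := RedSite.not_redSiteRP_uniform_of_moments ρ q hij hq1 hq2 hρ hN hz₀ hω hc₁ hR1
  obtain ⟨βl, hβl, hl⟩ := RedLink.not_redLinkRP_uniform_of_moments ρ q hij hq1 hq2 hρ hN hz₀ hω hc₁ hR1
  refine ⟨min (min βs βl) (1 / (12 * ((d - 1 : ℕ) : ℝ) * N + 1)),
    lt_min (lt_min hβs hβl) (by positivity), fun β hβ hβ1 => ⟨fun P L _ _ hP hL => ⟨?_, ?_⟩, ?_⟩⟩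
  · exact hs P L hP hL β hβ ((hβ1.trans (min_le_left _ _)).trans (min_le_left _ _))
  · exact hl P L hP hL β hβ ((hβ1.trans (min_le_left _ _)).trans (min_le_right _ _))
  · intro μ hμ
    have hβw : β ≤ 1 / (12 * ((d - 1 : ℕ) : ℝ) * N + 1) := hβ1.trans (min_le_right _ _)
    rw [le_div_iff₀ hW] at hβw
    have hβD : 6 * ((d - 1 : ℕ) : ℝ) * N * β < 1 := by nlinarith
    exact axisRP_of_mem_tiltedBoxLimitPoints_allGroups ρ hρ hβ.le hβD hμ i

/-- ★ **THE CONTRAST for `G ≅ U(N)`, `N ≥ 1`** (a direction pair `q₁, q₂ ≠ i`, `d ≥ 3`): one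
`β₁ > 0` such that for `0 < β ≤ β₁` every square tilted box `P, L ≥ 2` fails reduced-half in-plane
site and link RP along `i`, yet every tilted limit point is site- and link-RP along `i`. [folklore] -/
theorem boxes_fail_limit_holds_inPlaneRP_unitary (q : DirPair d) (hij : i ≠ j) (hq1 : q.1.1 ≠ i)
    (hq2 : q.1.2 ≠ i) (hρ : IsUnitaryModel ρ) (hN : 1 ≤ N) :
    ∃ β₁ : ℝ, 0 < β₁ ∧ ∀ β : ℝ, 0 < β → β ≤ β₁ →
      (∀ (P L : ℕ) [NeZero P] [NeZero L], 2 ≤ P → 2 ≤ L →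
        ¬ RedSite.RedSiteRP d i j L P ρ hij β ∧ ¬ RedLink.RedLinkRP d i j L P ρ hij β) ∧
      (∀ μ ∈ tiltedBoxLimitPoints d i j ρ β,
        IsReflectionPositiveFor (configSiteReflect (G := G) i) (siteHalfEdges i) μ ∧
          IsReflectionPositiveFor (configLinkReflect (G := G) i) (linkHalfEdges i) μ) := by
  obtain ⟨z₀, ω, hω, hz₀⟩ := DiagRPSUN.exists_smul_one_unitary ρ hρ
  have hNpos : (0 : ℝ) < N := by exact_mod_cast hN
  exact boxes_fail_limit_holds_inPlaneRP_of_moments ρ q hij hq1 hq2 hρ.1 hN hz₀ hω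
    (c₁ := (2 * N : ℝ)⁻¹) (by positivity) (DiagRPSUN.integral_re_trace_mul_inv_mul_unitary ρ hρ)

end TiltedRP

end Summit.QuantumFields.GaugeBoot

end
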